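import Mathlib
import HarnessLib
import HarnessLib.Audit
import Summits.CriticalPhenomena.Statement

/-!
Route: PercBurnResprinkle

CLOSED (exhausted) 2026-08-17T10:55:28Z by planner-rbadge-CriticalPhenomena-PercBurnRespr-629d0e20-0 — reason: exhausted — note: route-repair (rbadge) census. CONE: clean (0 unproved deps of 22; payload.unproved_cone_facts=[]) — nothing to re-route. S2 JumpFireBreak (7204): a THEOREM MODULO stmt-0853 — jumpFireBreak_of_thinDust + jumpFireBreak_of_finiteRadiusExpDecayOfTheta (Theorems/PercBurnResprinkleJumpFireBreak.lean p8062. The file is kept as the record of this route; refuted decls are indexed as negative knowledge (`ledger negatives`).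

# Route PercBurnResprinkle — burn and re-sprinkle — θ(p_c)=0 from 3-D forest-fire recovery of the
vacant set (locality of p_c of ℤ³ minus the thin infinite cluster) plus an Aizenman–Grimmett
fire-break in the jump world

It suffices to show X = VacantReignition ∧ JumpFireBreak (card
CriticalPhenomena/PercolationContinuityZ3/burn-and-resprinkle-vacant-set, its items S1 and S2).
Setting: two INDEPENDENT i.i.d.-uniform label fields π = (U, U′) on the edges of ℤ³ (labelMeasure ⊗
labelMeasure); the ENVIRONMENT ω_p = {U ≤ p} = configOfLabels p U with its burnt set I_p(U) = {y :
C_(ω_p)(y) is infinite} (the union of the infinite clusters, = the a.s. unique infinite cluster;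
defined without uniqueness), and a FRESH field ω′_q = configOfLabels q U′. The vacant fresh
configuration keeps the edges of ω′_q with both endpoints outside I_p(U): Bernoulli(q) bond
percolation on the induced random subgraph ℤ³[ℤ³∖I_p] ('burn the infinite cluster, re-sprinkle the
rest').
VacantReignition (S1, real world, supercritical side only): for every ε > 0 there is p > p_c(ℤ³)
such that with positive probability the origin lies in an infinite cluster of the vacant fresh
configuration at field level p_c + ε. Equivalently p_c(ℤ³∖I_p) → p_c(ℤ³) as p ↓ p_c: 'ℤ³ recovers
from fires' in vacant-set form (Ahlberg–Duminil-Copin–Kozma–Sidoravicius, Thm 2 and p. 3, proved for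
d large, explicitly open for d = 3).
JumpFireBreak (S2, jump world): if θ(p_c) > 0 then for some ε > 0 almost surely NO vertex lies in an
infinite cluster of the vacant fresh configuration with environment level p_c and field level p_c +
ε, i.e. p_c(ℤ³∖I_(p_c)) > p_c(ℤ³): deleting the would-be critical infinite cluster (a stationary set
of density θ(p_c) > 0, independent of the fresh field) is an essential diminishment that raises the
critical point STRICTLY (Aizenman–Grimmett strictness run in a stationary ergodic environment).
Lean: `(∀ ε : ℝ, 0 < ε → ∃ p : ℝ, Literature.Probability.Percolation.criticalProb
(Literature.Probability.LatticeModels.zdGraph 3) (0 : Fin 3 → ℤ) < p ∧ 0 <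
((Literature.Probability.Percolation.labelMeasure (Fin 3 → ℤ)).prod
(Literature.Probability.Percolation.labelMeasure (Fin 3 → ℤ))).real {π : (Sym2 (Fin 3 → ℤ) → ℝ) ×
(Sym2 (Fin 3 → ℤ) → ℝ) | (Literature.Probability.Percolation.openCluster {e | e ∈
Literature.Probability.Percolation.configOfLabels (Literature.Probability.Percolation.criticalProb
(Literature.Probability.LatticeModels.zdGraph 3) (0 : Fin 3 → ℤ) + ε) π.2
(Literature.Probability.LatticeModels.zdGraph 3) ∧ ∀ y ∈ e, ¬
(Literature.Probability.Percolation.openCluster (Literature.Probability.Percolation.configOfLabels p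
π.1 (Literature.Probability.LatticeModels.zdGraph 3)) y).Infinite} (0 : Fin 3 → ℤ)).Infinite}) ∧ (0
< Literature.Probability.Percolation.theta (Literature.Probability.LatticeModels.zdGraph 3) (0 : Fin
3 → ℤ) (Literature.Probability.Percolation.criticalProbI 3) → ∃ ε : ℝ, 0 < ε ∧
((Literature.Probability.Percolation.labelMeasure (Fin 3 → ℤ)).prod
(Literature.Probability.Percolation.labelMeasure (Fin 3 → ℤ))) {π : (Sym2 (Fin 3 → ℤ) → ℝ) × (Sym2
(Fin 3 → ℤ) → ℝ) | ∃ x : Fin 3 → ℤ, (Literature.Probability.Percolation.openCluster {e | e ∈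
Literature.Probability.Percolation.configOfLabels (Literature.Probability.Percolation.criticalProb
(Literature.Probability.LatticeModels.zdGraph 3) (0 : Fin 3 → ℤ) + ε) π.2
(Literature.Probability.LatticeModels.zdGraph 3) ∧ ∀ y ∈ e, ¬
(Literature.Probability.Percolation.openCluster (Literature.Probability.Percolation.configOfLabels
(Literature.Probability.Percolation.criticalProb (Literature.Probability.LatticeModels.zdGraph 3) (0
: Fin 3 → ℤ)) π.1 (Literature.Probability.LatticeModels.zdGraph 3)) y).Infinite} x).Infinite} = 0)`

## Assembly
Pure monotonicity (checked informally against Sketch.lean; provable now, short): suppose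
VacantReignition and JumpFireBreak and θ(p_c) ≠ 0; then θ(p_c) > 0 (a probability), JumpFireBreak
gives ε > 0 with the 'some vertex percolates in the vacant fresh configuration (environment level
p_c, field level p_c+ε)' set NULL; VacantReignition with this ε gives p > p_c with the 'origin
percolates (environment level p, field level p_c+ε)' set of POSITIVE measure. But pointwise in (U,
U′): configOfLabels p_c U ⊆ configOfLabels p U (configOfLabels_mono), hence openCluster monotone
(SimpleGraph.fromEdgeSet_mono, Reachable.mono), hence I_(p_c)(U) ⊆ I_p(U), hence the vacant fresh
configuration at environment level p is contained in the one at level p_c (same U′, same field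
level), hence its clusters are smaller; so the positive-measure set is contained in the null set
(take x = 0) — contradiction by measure monotonicity (Measure.real = toReal of the outer measure; no
measurability needed). Hence θ(p_c) = 0, which is PercolationContinuityZ3 by
percolationContinuityZ3_iff (criticalProbI 3 coerces to criticalProb (zdGraph 3) 0 by rfl).

Rationale: WHY THIS LINE. Burning the infinite cluster C_p of ω_p (p > p_c) and percolating afresh on its
complement probes the ORDER of the transition through one functional, q*(p) := p_c(ℤ³∖I_p): in the
monotone coupling I_(p_c) ⊆ I_p for every p ≥ p_c, so q*(p) ≥ q*(p_c) ≥ p_c pathwise, and a jump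
makes q*(p_c) > p_c by S2 while recovery makes inf_(p>p_c) q*(p) = p_c by S1 — the two are
incompatible by monotonicity alone (the assembly uses no limit interchange, no named fact, no
sprinkling at p_c). The line imports the self-destructive-percolation / forest-fire literature
(VandenbergBrouwer2004 model and planar conjecture; KissManolescuSidoravicius2015: planar lattices
do NOT recover, because a planar infinite cluster cuts the plane into finite pieces; AhlbergEtAl2015
= arXiv:1302.6872: ℤ^d recovers for d large, Thm 2 being exactly S1's shape, with the printed remark
that their one-arm-exponent renormalisation 'has no hope of working in ℤ³ (though this does not
preclude that ℤ³ recovers from fires)'; AhlbergSidoraviciusTykesson2014: non-amenable graphs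
recover) and the vacant-set viewpoint of random interlacements (Sznitman, Teixeira2015) for S1, and
Aizenman–Grimmett strict inequalities (AizenmanGrimmett1991; Grimmett1999 Thm (3.16) and the
diminishment remark p. 65; arXiv:1402.0834; ChayesSchonmann2000 = AG with i.i.d. random site
deletions) for S2, whose novelty is to run AG with the deleted set a stationary ergodic random set
independent of the field instead of a periodic or i.i.d. one. d = 3 is the lowest dimension where
the planar obstruction to recovery (separation by a curve) is absent, so the forest-fire dichotomy
aligns with the order of the transition exactly from d = 3 on. What prior routes and cards do not
do: every in-house use of AG (cards needle-threading-strict-diminishment-v2,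
periodic-sieve-plug-chain, dust-sandwich-continuity) deletes a PERIODIC deterministic sieve and
studies the critical cluster threading it; PercThresholdOne / PercPorousCritical percolate ON the
would-be critical cluster; here the deleted set is the infinite cluster itself and the percolating
object is its complement, and S1 lives entirely at honest supercritical parameters where uniqueness,
Grimmett–Marstrand and slab technology are legal.

RANKED CRUXES. #2 VacantReignition (crux) — S1 of the card ('re-ignition' / locality of p_c of the
vacant set): for every ε > 0 there is a real p > p_c(ℤ³) such that, under labelMeasure ⊗
labelMeasure, with positive probability the origin is in an infinite cluster of {e ∈ configOfLabels
(p_c+ε) U′ (zdGraph 3) : both endpoints of e lie outside I_p(U)}, I_p(U) = {y : openCluster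
(configOfLabels p U (zdGraph 3)) y infinite}. Monotone in p (smaller p, larger vacant set), so '∃ p
> p_c' = 'for all p close enough to p_c'; by translation invariance positivity at 0 = a.s. existence
of an infinite vacant fresh cluster; p ≥ 1 gives an empty vacant set, so the witness p is
automatically in (p_c, 1). [difficulty: open-problem] (why it might fail: Cages: near p_c the
infinite cluster could contain closed site-sheets at scales ≳ ξ(p) although θ(p) → 0 — in ℤ² every
vacant hole is finite and recovery fails (KMS 2015); the only proof (ADKS) needs one-arm exponent >
1, false in ℤ³ where π(r) ≥ c/r.) [AhlbergEtAl2015, arXiv:1302.6872, VandenbergBrouwer2004,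
KissManolescuSidoravicius2015, AhlbergSidoraviciusTykesson2014, EasoHutchcroft2024, Teixeira2015]
#3 JumpFireBreak (crux) — S2 of the card ('a discontinuous transition is its own fire-break'): if
θ(p_c(ℤ³)) > 0 then there is ε > 0 such that, under labelMeasure ⊗ labelMeasure, the set of label
pairs (U, U′) for which SOME vertex x has an infinite cluster in {e ∈ configOfLabels (p_c+ε) U′
(zdGraph 3) : both endpoints outside I_(p_c)(U)} is null — Bernoulli(p_c+ε) bond percolation on
ℤ³[ℤ³∖I_(p_c)] has a.s. no infinite cluster, i.e. p_c(ℤ³∖I_(p_c)) ≥ p_c + ε > p_c. Engine foreseen: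
Aizenman–Grimmett comparison of ∂/∂s and ∂/∂p for the two-parameter family 'delete each site of
I_(p_c) independently with probability s, fresh field at p', quenched in the environment (uniform
local surgery constants, support UniformDiminishment) plus an ergodic/FKG argument that a positive
fraction of the fresh field's pivotality mass sits within bounded distance of I_(p_c). [deps:
UniformDiminishment] [difficulty: L] (why it might fail: AG strictness FAILS for general stationary
positive-density deletions (random parallel planes of density t: p_c(ℤ³∖D) = p_c); I_(p_c) has
vacant boxes at all scales (finite energy) where the fresh field's pivotal edges may concentrate; a
proof needs uniqueness/FKG geometry of I_(p_c) — unwritten.) [AizenmanGrimmett1991, Grimmett1999,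
arXiv:1402.0834, ChayesSchonmann2000, AhlbergEtAl2015]
#4 VacantSetPercolates (crux) — S1 at field level q = 1 (the weakest recovery statement,
label-free): there is p ∈ (p_c(ℤ³), 1] such that with positive P_p-probability the origin lies in an
infinite connected component of the induced subgraph of ℤ³ on the vacant set {y : openCluster ω y
finite} — the complement of the (slightly) supercritical infinite cluster is not caged. Necessary
for VacantReignition (via map_configOfLabels); true for d large by ADKS Thm 2 (their proof removes
vertices); FALSE on ℤ² for every p > p_c (holes of a planar infinite cluster are finite); for SITE
percolation on ℤ³ it would be trivial (closed sites percolate for p < 1 − p_c^site), for BOND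
percolation it is not. [difficulty: L] (why it might fail: 3-D cages at level q = 1: if for every p
> p_c the vacant set ℤ³∖I_p has only finite components (the planar behaviour, KMS 2015) the whole
line dies; no sub-lattice or density argument applies since θ(p_c+) is not known to be small and I_p
is non-local.) [AhlbergEtAl2015, KissManolescuSidoravicius2015, VandenbergBrouwer2004, Grimmett1999]
#9 UniformDiminishment (support) — quenched, uniform Aizenman–Grimmett diminishment (the
deterministic core of any proof of JumpFireBreak; AizenmanGrimmett1991 / Grimmett1999 Thm (3.16)
with the remark on diminishments p. 65 and Example B p. 66, hypotheses as repaired in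
arXiv:1402.0834, constants made uniform in the deleted set): for every R there is g(R) > 0 such that
for EVERY set D ⊆ ℤ³ meeting every box x + [−R,R]³, every p ≤ p_c(ℤ³) + g(R) and every vertex x,
P_p-a.s. x is not in an infinite cluster of {e ∈ ω : both endpoints outside D} — i.e. p_c(ℤ³∖D) ≥
p_c(ℤ³) + g(R) uniformly over R-dense D (translation x ↦ D − x makes 'all x' free). Provable by the
printed AG argument: restoring a deleted vertex is an essential, monotone enhancement and the
local-surgery constants depend only on R and on p bounded away from 0 and 1. [difficulty: L]
[AizenmanGrimmett1991, Grimmett1999, arXiv:1402.0834, ChayesSchonmann2000]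

TWO-LAYER PLAN. Foreseen glued splits (nothing filed now; k ≤ 3, depth 1). JumpFireBreak ⇐
UniformDiminishment → EnvironmentEssential → JumpFireBreak, where EnvironmentEssential is the
jump-world statement that for the annealed two-parameter family (s = deletion probability of the
sites of I_(p_c), p = fresh level) the Russo sum over sites of I_(p_c) dominates a fixed fraction of
the Russo sum over all edges, uniformly in the box size (ergodicity of I_(p_c) under the product
measure + FKG geometry: I_(p_c) meets every line with frequency θ(p_c)). VacantReignition ⇐
VacantSetPercolates → NoSheetsAtScale → VacantReignition, where NoSheetsAtScale says: for p > p_c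
fixed, boxes of side L(p) = ξ(p)·polylog are crossed inside the vacant set by Bernoulli(p_c+ε)
clusters with probability → 1 as p ↓ p_c (then a finite-size criterion at the FIXED supercritical
pair (p, p_c+ε), where sprinkling and Grimmett–Marstrand are legal and the burnt set is local up to
exp(−cL/ξ) errors by supercritical finite-cluster decay, gives S1).

KILL CRITERIA. VacantSetPercolates refuted (3-D cages: ℤ³∖I_p has only finite components for all p >
p_c) ⇒ VacantReignition is false too ⇒ close `refuted:VacantSetPercolates` and file the witness as a
barrier 'ℤ³ does not recover from fires' (it would also settle the ADKS question negatively).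
VacantReignition refuted with VacantSetPercolates intact (recovery needs a definite extra density,
the KMS behaviour in 3-D) ⇒ close `refuted:VacantReignition`. JumpFireBreak cannot be refuted by a
theorem short of exhibiting the jump itself; it is KILLED AS A MECHANISM if a refuter exhibits a
stationary, FKG, uniquely-percolating, line-meeting random set D ⊆ ℤ³ independent of the field with
p_c(ℤ³∖D) = p_c(ℤ³) (an 'AG-immune Potemkin environment') — then pivot: restate S2 with the extra
Bernoulli-specific structure the witness lacks, or close `exhausted`. θ(p_c) = 0 proved elsewhere
moots S2 (vacuous) and the route; S1/S0 keep their forest-fire interest but leave this summit.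

NOT DECOMPOSED YET. The sheet-Peierls / 'no closed site-sheets inside one slightly supercritical
cluster' estimate that is S1's real engine (layer-2 child NoSheetsAtScale above, only after S0 or S2
moves); the zero–one law and translation invariance of labelMeasure ⊗ labelMeasure (provers attach
them with --supports); the forest-fire dictionary proper — card item L1 'S1 ⇒ δ_c(p) → 0 for van den
Berg–Brouwer self-destructive percolation' is NOT filed: the conditional law of the outside edges
given I_p = S is not exactly product (the event 'no other infinite cluster off S' is non-local), so
L1 needs uniqueness plus a careful conditioning argument and is motivation, not load-bearing; the
general-p fire-break 'θ(p) > 0 ⇒ p_c(ℤ³∖I_p) > p' is NOT filed either: the only scale of ℤ³∖I_p is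
ξ(p), so scaling predicts p_c(ℤ³∖I_p) − p_c ≈ C·(p − p_c) and its truth near p_c hinges on an
unknown constant C ≷ 1 (only the p = p_c, positive-density case is load-bearing); whether to burn
I_p or 'I_p plus its finite pendants'; named Literature definitions for the burnt set / vacant
configuration (inlined for now).

CHEAPEST FALSIFIER. Monte Carlo (kit, one evening): bond percolation on the torus (ℤ/Lℤ)³, L = 64,
96, 128, at p = p_c + δ, δ ∈ {0.005, 0.01, 0.02, 0.04} (p_c = 0.2488126); delete the vertices of the
largest cluster; (a) does the induced vacant subgraph have a giant component (VacantSetPercolates)?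
(b) estimate its bond threshold q*(p) from wrapping probabilities of an independent Bernoulli(q)
field on it (VacantReignition predicts q*(p) − p_c → 0 as δ → 0; a plateau q*(p) ≥ p_c + c, the
Kiss–Manolescu–Sidoravicius planar behaviour, kills S1 and the route); (c) the response ratio (q*(p)
− p_c)/θ_L(p): if it tends to 0 the heuristic behind JumpFireBreak ('deleting the infinite cluster
costs at least a fixed multiple of its density') is weak in the real world (not a refutation of the
jump-world statement, but a warning). Not run by the planner (plancard is one-shot; no kit budget in
the payload). Literature lookup already done: no d = 3 recovery result exists (ADKS p. 4 leave it
open; vdB–Nolin arXiv:1810.08181 / 2106.10183 are planar).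

NUMBERS. p_c(ℤ³, bond) = 0.2488126(5) (numerics); β ≈ 0.418, ν ≈ 0.877, so θ(p_c+0.01) ≈ 0.2 and the
vacant density is ≈ 0.8 there; cluster fractal dimension ≈ 2.52 > 2 (sheets are dimensionally
possible, hence S0 is not free); rigorous one-arm lower bound π(r) ≥ c/r in ℤ³ (ADKS p. 4, after van
den Berg–Kesten 1985 / Kesten 1982), which is why the ADKS renormalisation (needs π(r) ≤ r^(−1−c))
stops at d large / spread-out d > 6; p_c^site(ℤ³) ≈ 0.3116 (why the SITE version of S0 is trivial
and the BOND version is not); planar: δ_c(p) ≥ δ > 0 for all p > p_c (KMS 2015, Thm 1.1);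
Grimmett1999 §3.3 Example D: the complement of the infinite CLOSED cluster percolates for an
interval of p < p_c (an AG-enhancement cousin of S0). Items at open: 5 (3 cruxes, 1 support, 1
assembly).

DEFINITION REQUESTS. None required: every statement elaborates over existing declarations
(labelMeasure, configOfLabels, openCluster, bondPercolation, theta, criticalProb, criticalProbI,
zdGraph, box; Sketch.lean rc 0). Suggested, not filed: Literature/Probability/Percolation notions
`infiniteClusterSet ω := {y | (openCluster ω y).Infinite}`, `vacantRestrict ω′ S := {e ∈ ω′ | ∀ y ∈
e, y ∉ S}` and the van den Berg–Brouwer self-destructive configuration, which would shorten all four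
statements and let L1 be typed.

Novelty: Searches (2026-08-15): `lit search "self-destructive percolation forest fire recovery"` (local 8
docs: Ráth–Tóth arXiv:0808.2116, van den Berg–Nolin arXiv:1810.08181 and arXiv:2106.10183, Graf
2016, frozen-percolation papers — all planar / mean-field; crossref 15 incl. doi:10.1002/rsa.20003,
doi:10.1214/ecp.v19-2611); `lit galaxy search "self-destructive percolation" --star all` (1 row, the
Bollobás–Riordan book blurb; pdf/crabby 0); `lit search --hybrid "strict inequality critical
probability essential enhancement subgraph Aizenman Grimmett"` (Grimmett1999 pp. 61–77,
BollobasRiordan2006 p. 270); `lit vsearch "critical probability of Bernoulli percolation on the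
complement of the infinite cluster"` (10 book hits, none specific: LyonsPeres2016, Grimmett RCM,
Kesten1982 …); crossref "Chayes Schonmann mixed percolation" (doi:10.1214/aoap/1019487612); `lit
frontier CriticalPhenomena --since 2022` (30 rows, nothing on forest fires / vacant sets); `lit
bridges CriticalPhenomena --cross any`; `lit read arXiv:1302.6872` pp. 1–4 and Grimmett1999 PDF pp.
76–79 read; `ledger idea list` (all cards of the sub: no other card burns the infinite cluster or
percolates on its complement); OpenAlex / Semantic Scholar / arXiv APIs rate-limited (HTTP 429)
today, recorded.
Nearest prior art found: AhlbergEtAl2015 = arXiv:1302.6872 (Thm 2 and p. 3: 'the critical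
probability for percolation on the random graph obtained from ℤ^d by removing a sufficiently thin
supercritical cluster is a.s. at most p_  [refs: 10.1002/rsa.20003, 10.1214/ecp.v19-2611, 10.1214/aoap/1019487612, 0808.2116, 1810.08181, 2106.10183, 1302.6872, doi:10.1002/rsa.20003, doi:10.1214/ecp.v19-2611, doi:10.1214/aoap/1019487612, Grimmett1999, BollobasRiordan2006, LyonsPeres2016, Kesten1982, AhlbergEtAl2015, KissManolescuSidoravicius2015, VandenbergBrouwer2004, ChayesSchonmann2000, AizenmanGrimmett1991]

Barriers (technique_class: vacant-set-locality, aizenman-grimmett-environment): - technique_class: vacant-set-locality, aizenman-grimmett-environment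
- Literature.Barriers.CriticalPhenomena.SprinklingRenormalisation: sprinkling / Grimmett–Marstrand
are used only inside S1, at the honest supercritical pair (environment p > p_c, field p_c + ε > p_c)
where 'η > 0' is available; percolation AT p_c is never certified by a finite-size criterion — the
contradiction at p_c comes from the STRICT inequality S2, not from η → 0.
- Literature.Barriers.CriticalPhenomena.SlabLimitUniformControl: the limit p ↓ p_c in S1 is a limit
of critical POINTS q*(p) of random subgraphs, and the assembly needs no modulus and no limit
interchange: q*(p) ≥ q*(p_c) pathwise by subgraph monotonicity (the semicontinuity goes the right
way; card constant-pc-exhaustion-witness does not bite). Conceded: S1 itself may hide difficulty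
comparable to the conjunct (ADKS: 'no hope in ℤ³' for their method).
- Literature.Barriers.CriticalPhenomena.TransverseCrossingsNeedNotMeet: no path-gluing at p_c is
attempted; S1's engine is a statement about SURFACES (absence of site-sheets inside one cluster),
where 3-D topology enters positively (a cage costs area), and S2's engine is Russo/AG local surgery,
dimension-blind.
- Literature.Barriers.CriticalPhenomena.LongRangeDiscontinuity: S2 and the vertex-deletion picture
use nearest-neighbour structure (edges incident to the burnt set; AG local modifications); for the
Aizenman–Newman 1/r² chains long edges jump over any burnt set, 'recovery' is automatic a

Novelty grade: new-combination — refuter route-review 2026-08-15: new-combination is FAIR for (ADKS fresh-field S1-shape) + (AG strictness with the critical infinite cluster itself as stationary FKG environment, S2 — unwritten anywhere found: arXiv API 'self-destructive percolation' 6 hits all planar/tree/high-d, 'recovers from fir (refuter refuter-rreview-route-CriticalPhenomena--7f1b1fc9-0, 2026-08-15T14:02:15Z; prior: arXiv:1302.6872 (ADKS 2015 Thm 2: S1-shape, d large), arXiv:1312.7004 (KMS 2015: planar non-recovery), AizenmanGrimmett1991 / Grimmett1999 Thm (3.16), ChayesSchonmann2000 doi:10.1214/aoap/1019487612 (AG with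 i.i.d. deletions), Literature.Barriers.CriticalPhenomena.SlabLimitUniformControl (narrowed audit: uniform control ⟺ conjunct))

History (route lifecycle, newest last):
- 2026-08-17T10:20:24Z · skeleton.hides-summit: stub_curtainDust (stmt-CriticalPhenomena-7203) ⟷ summit (accepted theorem in Summits/CriticalPhenomena/PercolationContinuityZ3/Theorems/VacantReignition/Negative/CurtainDustForcesContinuity.lean) (prover-line-stmt-CriticalPhenomena-7203-c2-0)
- 2026-08-17T10:55:28Z · CLOSED exhausted — exhausted (planner-rbadge-CriticalPhenomena-PercBurnRespr-629d0e20-0)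

sub-problem: PercolationContinuityZ3 · status: closed(exhausted) · opened planner-plancard-CriticalPhenomena-Percolatio-ebd276f0-0 2026-08-15T12:05:07Z · rev 3 · ledger route-CriticalPhenomena-PercBurnResprinkle
GENERATED by the gate from the ledger (D-0016/17). Provers cite these decls: `theorem foo : Summit.CriticalPhenomena.PercolationContinuityZ3.Theses.PercBurnResprinkle.<Decl> := …` in Summits/CriticalPhenomena/PercolationContinuityZ3/Theorems/<Name>.lean.
-/

namespace Summit.CriticalPhenomena.PercolationContinuityZ3.Theses.PercBurnResprinkle

open scoped BigOperators Topology Manifold Classical MeasureTheory ProbabilityTheory Matrix InnerProductSpace ComplexConjugate ContinuousMap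
open Filter Set Function TopologicalSpace MeasureTheory

attribute [summit_statement] _root_.PercolationContinuityZ3

/-- item stmt-CriticalPhenomena-7203 · crux · rank 2 · closed · moot by None · by planner
why it might fail: Consumed core is ¬FB (q*(p_c)=p_c): in a jump world S1 must beat AG strictness (S2's own engine), so a proof decides θ(p_c)=0 en route; even given continuity ℤ³ recovery is open (ADKS p.4: π(r)≥c/r, 'no hope in ℤ³'), forces p_c<p_fin(3) (only d≥10 known) and fails in ℤ² (KMS Thm 1).
sources: AhlbergEtAl2015, arXiv:1302.6872, KissManolescuSidoravicius2015, GrimmettHolroydKozma2014, BockEtAl2020, KanazawaBobrowskiSkraba2026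
[crux] S1 of the card ('re-ignition' / locality of p_c of the vacant set): for every ε > 0 there is
a real p > p_c(ℤ³) such that, under labelMeasure ⊗ labelMeasure, with positive probability the
origin is in an infinite cluster of {e ∈ configOfLabels (p_c+ε) U′ (zdGraph 3) : both endpoints of e
lie outside I_p(U)}, I_p(U) = {y : openCluster (configOfLabels p U (zdGraph 3)) y infinite}.
Monotone in p (smaller p, larger vacant set), so '∃ p > p_c' = 'for all p close enough to p_c'; by
translation invariance positivity at 0 = a.s. existence of an infinite vacant fresh cluster; p ≥ 1
gives an empty vacant set, so the witness p is automatically in (p_c, 1). [difficulty: open-problem] -/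
@[route_item "route-CriticalPhenomena-PercBurnResprinkle"]
def VacantReignition : Prop :=
  ∀ ε : ℝ, 0 < ε → ∃ p : ℝ, Literature.Probability.Percolation.criticalProb (Literature.Probability.LatticeModels.zdGraph 3) (0 : Fin 3 → ℤ) < p ∧ 0 < ((Literature.Probability.Percolation.labelMeasure (Fin 3 → ℤ)).prod (Literature.Probability.Percolation.labelMeasure (Fin 3 → ℤ))).real {π : (Sym2 (Fin 3 → ℤ) → ℝ) × (Sym2 (Fin 3 → ℤ) → ℝ) | (Literature.Probability.Percolation.openCluster {e | e ∈ Literature.Probability.Percolation.configOfLabels (Literature.Probability.Percolation.criticalProb (Literature.Probability.LatticeModels.zdGraph 3) (0 : Fin 3 → ℤ) + ε) π.2 (Literature.Probability.LatticeModels.zdGraph 3) ∧ ∀ y ∈ e, ¬ (Literature.Probability.Percolation.openCluster (Literature.Probability.Percolation.configOfLabels p π.1 (Literature.Probability.LatticeModels.zdGraph 3)) y).Infinite} (0 : Fin 3 → ℤ)).Infinite}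

/-- item stmt-CriticalPhenomena-7204 · crux · rank 3 · closed · moot by None · by planner
why it might fail: AG strictness fails for general stationary positive-density deletions (D=ℤ²×S, S Bernoulli: slabs of all widths survive, p_c(ℤ³∖D)=p_c by Grimmett-Marstrand); AG surgery covers bounded gaps only (DHKS 2016), random gaps took planar RSW (HSS 2022: 3-D hard); I_(p_c) has holes at every scale.
sources: AizenmanGrimmett1991, Grimmett1999, BalisterBollobasRiordan2014, ChayesSchonmann2000, GrimmettMarstrand1990, DuminilcopinEtAl2016
[crux] S2 of the card ('a discontinuous transition is its own fire-break'): if θ(p_c(ℤ³)) > 0 then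
there is ε > 0 such that, under labelMeasure ⊗ labelMeasure, the set of label pairs (U, U′) for
which SOME vertex x has an infinite cluster in {e ∈ configOfLabels (p_c+ε) U′ (zdGraph 3) : both
endpoints outside I_(p_c)(U)} is null — Bernoulli(p_c+ε) bond percolation on ℤ³[ℤ³∖I_(p_c)] has a.s.
no infinite cluster, i.e. p_c(ℤ³∖I_(p_c)) ≥ p_c + ε > p_c. Engine foreseen: Aizenman–Grimmett
comparison of ∂/∂s and ∂/∂p for the two-parameter family 'delete each site of I_(p_c) independently
with probability s, fresh field at p', quenched in the environment (uniform local surgery constants,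
support UniformDiminishment) plus an ergodic/FKG argument that a positive fraction of the fresh
field's pivotality mass sits within bounded distance of I_(p_c). [deps: UniformDiminishment]
[difficulty: L] -/
@[route_item "route-CriticalPhenomena-PercBurnResprinkle"]
def JumpFireBreak : Prop :=
  0 < Literature.Probability.Percolation.theta (Literature.Probability.LatticeModels.zdGraph 3) (0 : Fin 3 → ℤ) (Literature.Probability.Percolation.criticalProbI 3) → ∃ ε : ℝ, 0 < ε ∧ ((Literature.Probability.Percolation.labelMeasure (Fin 3 → ℤ)).prod (Literature.Probability.Percolation.labelMeasure (Fin 3 → ℤ))) {π : (Sym2 (Fin 3 → ℤ) → ℝ) × (Sym2 (Fin 3 → ℤ) → ℝ) | ∃ x : Fin 3 → ℤ, (Literature.Probability.Percolation.openCluster {e | e ∈ Literature.Probability.Percolation.configOfLabels (Literature.Probability.Percolation.criticalProb (Literature.Probability.LatticeModels.zdGraph 3) (0 : Fin 3 → ℤ) + ε) π.2 (Literature.Probability.LatticeModels.zdGraph 3) ∧ ∀ y ∈ e, ¬ (Literature.Probability.Percolation.openCluster (Literature.Probability.Percolation.configOfLabels (Literature.Probability.Percolation.criticalProb (Literature.Probability.LatticeModels.zdGraph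 3) (0 : Fin 3 → ℤ)) π.1 (Literature.Probability.LatticeModels.zdGraph 3)) y).Infinite} x).Infinite} = 0

/-- item stmt-CriticalPhenomena-7205 · crux · rank 4 · closed · moot by None · by planner
why it might fail: Equivalent to p_c(3)<p_fin(3): GHK 2014 open question (3≤d≤18), still open 2026 — known only for d≥10 (BDNS 2020 shielded paths; KBS 2026 §2.3), d≥7 with numerical p_c; GHK/ADKS need one-arm ≪ 1/r vs π(r)≥c/r in ℤ³; p_fin=p_c in ℤ² (duality): 3-D cages kill the line.
sources: GrimmettHolroydKozma2014, arXiv:1303.1657, BockEtAl2020, arXiv:1811.01678, KanazawaBobrowskiSkraba2026, AhlbergEtAl2015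
[crux] S1 at field level q = 1 (the weakest recovery statement, label-free): there is p ∈ (p_c(ℤ³),
1] such that with positive P_p-probability the origin lies in an infinite connected component of the
induced subgraph of ℤ³ on the vacant set {y : openCluster ω y finite} — the complement of the
(slightly) supercritical infinite cluster is not caged. Necessary for VacantReignition (via
map_configOfLabels); true for d large by ADKS Thm 2 (their proof removes vertices); FALSE on ℤ² for
every p > p_c (holes of a planar infinite cluster are finite); for SITE percolation on ℤ³ it would
be trivial (closed sites percolate for p < 1 − p_c^site), for BOND percolation it is not.
[difficulty: L] -/
@[route_item "route-CriticalPhenomena-PercBurnResprinkle"]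
def VacantSetPercolates : Prop :=
  ∃ p : unitInterval, Literature.Probability.Percolation.criticalProb (Literature.Probability.LatticeModels.zdGraph 3) (0 : Fin 3 → ℤ) < (p : ℝ) ∧ 0 < (Literature.Probability.Percolation.bondPercolation (Literature.Probability.LatticeModels.zdGraph 3) p).real {ω | (Literature.Probability.Percolation.openCluster {e | e ∈ (Literature.Probability.LatticeModels.zdGraph 3).edgeSet ∧ ∀ y ∈ e, ¬ (Literature.Probability.Percolation.openCluster ω y).Infinite} (0 : Fin 3 → ℤ)).Infinite}

/-- item stmt-CriticalPhenomena-7206 · support · rank 9 · closed · proved by Summit.CriticalPhenomena.PercolationContinuityZ3.Theorems.UniformDiminishment_proof @ 44f44e32e03c (prover) · by planner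
sources: AizenmanGrimmett1991, Grimmett1999, arXiv:1402.0834, ChayesSchonmann2000, DuminilcopinEtAl2016
[support] quenched, uniform Aizenman–Grimmett diminishment (the deterministic core of any proof of
JumpFireBreak; AizenmanGrimmett1991 / Grimmett1999 Thm (3.16) with the remark on diminishments p. 65
and Example B p. 66, hypotheses as repaired in arXiv:1402.0834, constants made uniform in the
deleted set): for every R there is g(R) > 0 such that for EVERY set D ⊆ ℤ³ meeting every box x +
[−R,R]³, every p ≤ p_c(ℤ³) + g(R) and every vertex x, P_p-a.s. x is not in an infinite cluster of {e
∈ ω : both endpoints outside D} — i.e. p_c(ℤ³∖D) ≥ p_c(ℤ³) + g(R) uniformly over R-dense D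
(translation x ↦ D − x makes 'all x' free). Provable by the printed AG argument: restoring a deleted
vertex is an essential, monotone enhancement and the local-surgery constants depend only on R and on
p bounded away from 0 and 1. [difficulty: L] -/
@[route_item "route-CriticalPhenomena-PercBurnResprinkle"]
def UniformDiminishment : Prop :=
  ∀ R : ℕ, ∃ g : ℝ, 0 < g ∧ ∀ D : Set (Fin 3 → ℤ), (∀ x : Fin 3 → ℤ, ∃ y ∈ D, y - x ∈ Literature.Probability.LatticeModels.box 3 R) → ∀ p : unitInterval, (p : ℝ) ≤ Literature.Probability.Percolation.criticalProb (Literature.Probability.LatticeModels.zdGraph 3) (0 : Fin 3 → ℤ) + g → ∀ x : Fin 3 → ℤ, Literature.Probability.Percolation.bondPercolation (Literature.Probability.LatticeModels.zdGraph 3) p {ω | (Literature.Probability.Percolation.openCluster {e | e ∈ ω ∧ ∀ y ∈ e, y ∉ D} x).Infinite} = 0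

/-- item stmt-CriticalPhenomena-7207 · assembly · rank 1 · closed · proved by Summit.CriticalPhenomena.PercolationContinuityZ3.Theorems.assembly_proof (prover) · by planner
sources: AhlbergEtAl2015, AizenmanGrimmett1991, Grimmett1999
[assembly] VacantReignition → JumpFireBreak → PercolationContinuityZ3 (θ(p_c(ℤ³)) = 0). -/
@[route_item "route-CriticalPhenomena-PercBurnResprinkle"]
def Assembly : Prop :=
  VacantReignition → JumpFireBreak → PercolationContinuityZ3

end Summit.CriticalPhenomena.PercolationContinuityZ3.Theses.PercBurnResprinkle
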